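import Summits.CriticalPhenomena.PercolationContinuityZ3.Theorems.PercAnnulusCrossingTubeCorrelationLength
import HarnessLib

/-!
# RSW3 lane: the TUBE CORRELATION LENGTH, VI — the converse direction: a bounded rate forces the MULTIPLICATIVE
# GLUING inequality infinitely often (ratio test vs root test)

builds on p205010 (kernel theorem, internal audit signed; external expert review pending)

RSW3 lane (LANE 3 `prim-rsw3`), lead seat, gen 4.  Helper file (`--supports`); no definitions, no named facts, no
sorries.  Notation of part I: `H_p(a; n) = P_p(boxCross ![a,n,n] 0)`, `μ_p(n) = -(subadditive_log_hardCrossing p hp n).lim`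
(`-log H_p(a;n)/a → μ_p(n)`), `Π_p(n)` the cube.  Part I showed: a multiplicative / conditional block-gluing constant valid
for ALL `a` bounds `n·μ_p(n)` (`rate_mul_le_of_condBlockGluingAt`; with the cube, RSW — V52/V63/V74).  Here the converse,
which is a "ratio test versus root test" statement and therefore only holds along a subsequence of lengths:

* `neg_log_le_rate_mul_of_geometric_upper` — mirror of the transfer lemma: `H_p(s + kt; n) ≤ A·ρ^k` for all `k` forces
  `log(1/ρ) ≤ μ_p(n)·t`;
* `frequently_exp_mul_hardCrossing_le_shift` — **for every `t` and `ε > 0`: `e^{-(μ_p(n)+ε)t}·H_p(a; n) ≤ H_p(a+t; n)` for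
  infinitely many `a`** (`limsup_a H(a+t)/H(a) ≥ e^{-μ t}`; an eventual failure would be a geometric upper bound with ratio
  `< e^{-μt}`, contradicting the rate);
* `frequently_multGluing_of_rate_bounded` — **at `p_c(ℤ³)`: if `n·μ_{p_c}(n) ≤ C` for all `n ≥ 1` (⟺ hard-direction RSW with
  geometric constants, part II), then for every `n ≥ 1` the multiplicative gluing inequality
  `e^{-(C+1)}·H(a; n)·Π(n) ≤ H(a + n - ⌊n/2⌋; n)` holds for INFINITELY MANY `a`** — the converse of
  `hardCrossingLowerBound_of_cube_and_condBlockGluing` / `rate_bounded_of_cube_and_condBlockGluing` up to "for all `a`"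
  versus "for infinitely many `a`" (which is all a rate can see).

Reading: RSW ⟹ the census's multiplicative gluing constant `c′ = g·h` (Q18: `≈ 0.85`, flat in `a/n ≤ 3`; non-rigorous) cannot
tend to `0` along ALL `a` at any fixed `n`; conversely `c′ ≥ c > 0` for all `a, n` ⟹ RSW.  So `inf_n liminf_a (g·h)(a,n) > 0` and
`inf_n limsup_a (g·h)(a,n) > 0` bracket the RSW statement.

References: G. Grimmett, *Percolation* (1999), App. II (subadditivity); W. Rudin, *Principles of Mathematical Analysis*,
Thm. 3.37 (ratio vs root test). [folklore]
-/

noncomputable section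

namespace Summit.CriticalPhenomena.PercolationContinuityZ3.Theorems.Crossing

open MeasureTheory Filter Topology Literature.Probability.LatticeModels Literature.Probability.Percolation SimpleGraph
open Summit.CriticalPhenomena.PercolationContinuityZ3.Theorems.SurfaceTension
open Summit.CriticalPhenomena.PercolationContinuityZ3.Theorems.Rsw3
open Summit.CriticalPhenomena.PercolationContinuityZ3.Theses

/-- **Mirror transfer lemma.**  If `H_p(s + k·t; n) ≤ A·ρ^k` for every `k` (`t ≥ 1`, `A, ρ > 0`), then `log(1/ρ) ≤ μ_p(n)·t`.
[folklore] -/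
theorem neg_log_le_rate_mul_of_geometric_upper (p : unitInterval) (hp : 0 < (p : ℝ)) (n : ℕ) {s t : ℕ} (ht : 1 ≤ t)
    {A ρ : ℝ} (hA : 0 < A) (hρ : 0 < ρ)
    (h : ∀ k : ℕ, (bondPercolation (zdGraph 3) p).real (boxCross (![((s + k * t : ℕ) : ℤ), n, n] : Site 3) 0) ≤ A * ρ ^ k) :
    -Real.log ρ ≤ -(subadditive_log_hardCrossing p hp n).lim * (t : ℝ) := by
  set L := (subadditive_log_hardCrossing p hp n).lim with hL
  set v : ℕ → ℝ := fun k =>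
    Real.log ((bondPercolation (zdGraph 3) p).real (boxCross (![((k - 1 : ℕ) : ℤ), n, n] : Site 3) 0)) with hv
  have ht' : (0 : ℝ) < t := by exact_mod_cast ht
  have hm : Tendsto (fun k : ℕ => s + k * t + 1) atTop atTop := by
    refine tendsto_atTop_mono (fun k => ?_) tendsto_id
    have : k ≤ k * t := Nat.le_mul_of_pos_right k ht
    simp only [id_eq]
    omega
  have hsub : Tendsto (fun k : ℕ => v (s + k * t + 1) / (((s + k * t + 1 : ℕ) : ℝ))) atTop (𝓝 L) :=
    (tendsto_log_hardCrossing_div p hp n).comp hm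
  set c := Real.log ρ / (t : ℝ) with hc
  have hden : Tendsto (fun k : ℕ => (s : ℝ) + (k : ℝ) * t + 1) atTop atTop :=
    tendsto_atTop_add_const_right _ _
      (tendsto_atTop_add_const_left _ _ (tendsto_natCast_atTop_atTop.atTop_mul_const ht'))
  have hlim : Tendsto (fun k : ℕ => (Real.log A + (k : ℝ) * Real.log ρ) / ((s : ℝ) + (k : ℝ) * t + 1))
      atTop (𝓝 c) := by
    have h0 : Tendsto (fun k : ℕ => (Real.log A - c * ((s : ℝ) + 1)) / ((s : ℝ) + (k : ℝ) * t + 1))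
        atTop (𝓝 0) := tendsto_const_nhds.div_atTop hden
    have h1 := h0.const_add c
    rw [add_zero] at h1
    refine h1.congr' (Eventually.of_forall fun k => ?_)
    have hden' : (s : ℝ) + (k : ℝ) * t + 1 ≠ 0 := by positivity
    rw [hc]
    field_simp
    ring
  have hle : ∀ k : ℕ, v (s + k * t + 1) / (((s + k * t + 1 : ℕ) : ℝ)) ≤
      (Real.log A + (k : ℝ) * Real.log ρ) / ((s : ℝ) + (k : ℝ) * t + 1) := by
    intro k
    have hk := h k
    have hpos := hardCrossing_pos p hp (s + k * t) n
    have hlog := Real.log_le_log hpos hk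
    rw [Real.log_mul hA.ne' (pow_pos hρ k).ne', Real.log_pow] at hlog
    have hs : (s + k * t + 1 - 1 : ℕ) = s + k * t := by omega
    simp only [hv, hs]
    push_cast
    exact div_le_div_of_nonneg_right hlog (by positivity)
  have hLc : L ≤ c := le_of_tendsto_of_tendsto' hsub hlim hle
  rw [hc, le_div_iff₀ ht'] at hLc
  linarith

/-- **`limsup_a H_p(a+t; n)/H_p(a; n) ≥ e^{-μ_p(n) t}`, in the form: for every `t` and `ε > 0`,
`e^{-(μ_p(n)+ε)·t}·H_p(a; n) ≤ H_p(a+t; n)` for infinitely many `a`.**  (Otherwise the shifts give a geometric upper bound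
with ratio `e^{-(μ+ε)t}`, and the mirror transfer lemma contradicts the rate.) [folklore] -/
theorem frequently_exp_mul_hardCrossing_le_shift (p : unitInterval) (hp : 0 < (p : ℝ)) (n t : ℕ) {ε : ℝ} (hε : 0 < ε) :
    ∃ᶠ a : ℕ in atTop, Real.exp (-((-(subadditive_log_hardCrossing p hp n).lim + ε) * t)) *
        (bondPercolation (zdGraph 3) p).real (boxCross (![(a : ℤ), n, n] : Site 3) 0) ≤
      (bondPercolation (zdGraph 3) p).real (boxCross (![((a + t : ℕ) : ℤ), n, n] : Site 3) 0) := by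
  set μ := -(subadditive_log_hardCrossing p hp n).lim with hμ
  set ρ := Real.exp (-((μ + ε) * t)) with hρ
  rcases Nat.eq_zero_or_pos t with rfl | ht
  · refine Frequently.of_forall fun a => ?_
    have hρ1 : ρ = 1 := by rw [hρ]; simp
    rw [hρ1, one_mul, add_zero]
  by_contra hnot
  rw [Filter.not_frequently] at hnot
  obtain ⟨a₀, ha₀⟩ := eventually_atTop.1 hnot
  -- geometric upper bound along `a₀ + k t`
  set A := (bondPercolation (zdGraph 3) p).real (boxCross (![(a₀ : ℤ), n, n] : Site 3) 0) with hA
  have hA0 : 0 < A := hardCrossing_pos p hp a₀ n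
  have hρ0 : 0 < ρ := Real.exp_pos _
  have hgeo : ∀ k : ℕ, (bondPercolation (zdGraph 3) p).real
      (boxCross (![((a₀ + k * t : ℕ) : ℤ), n, n] : Site 3) 0) ≤ A * ρ ^ k := by
    intro k
    induction k with
    | zero => simp [hA]
    | succ k ih =>
      have hk := ha₀ (a₀ + k * t) (Nat.le_add_right _ _)
      rw [not_le] at hk
      have heq : (a₀ + k * t + t : ℕ) = a₀ + (k + 1) * t := by ring
      rw [heq] at hk
      have hcast : (((a₀ + k * t : ℕ) : ℤ)) = ((a₀ + k * t : ℕ) : ℤ) := rfl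
      calc (bondPercolation (zdGraph 3) p).real (boxCross (![((a₀ + (k + 1) * t : ℕ) : ℤ), n, n] : Site 3) 0)
          ≤ ρ * (bondPercolation (zdGraph 3) p).real (boxCross (![((a₀ + k * t : ℕ) : ℤ), n, n] : Site 3) 0) := by
            have := hk.le
            simpa using this
        _ ≤ ρ * (A * ρ ^ k) := mul_le_mul_of_nonneg_left ih hρ0.le
        _ = A * ρ ^ (k + 1) := by ring
  have hmain := neg_log_le_rate_mul_of_geometric_upper p hp n (s := a₀) ht hA0 hρ0 hgeo
  rw [hρ, Real.log_exp] at hmain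
  have ht' : (1 : ℝ) ≤ t := by exact_mod_cast ht
  -- `(μ + ε) t ≤ μ t`: contradiction
  nlinarith

/-- **RSW forces multiplicative gluing infinitely often.**  At `p_c(ℤ³)`: if `n·μ_{p_c}(n) ≤ C` for all `n ≥ 1` (⟺
hard-direction RSW at every aspect with geometric constants, `rate_bounded_iff_exp_hardCrossing`), then for every `n ≥ 1`
the multiplicative block-gluing inequality **`e^{-(C+1)}·H(a; n)·Π(n) ≤ H(a + n - ⌊n/2⌋; n)` holds for infinitely many `a`**
(take `t = n - ⌊n/2⌋`, `ε = 1/n` above and `Π ≤ 1`).  Converse, up to "∀ a" vs "∃^∞ a", of the lane's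
'multiplicative gluing ∀ a ∧ cube ⇒ RSW' (p220372/p221328, V52/V63). [cite: Kesten1982, §3.3 Comment (v)] -/
theorem frequently_multGluing_of_rate_bounded (hp : 0 < ((criticalProbI 3 : unitInterval) : ℝ)) {C : ℝ}
    (hC : ∀ n : ℕ, 1 ≤ n → (n : ℝ) * -(subadditive_log_hardCrossing (criticalProbI 3) hp n).lim ≤ C)
    {n : ℕ} (hn : 1 ≤ n) :
    ∃ᶠ a : ℕ in atTop, Real.exp (-(C + 1)) *
        ((bondPercolation (zdGraph 3) (criticalProbI 3)).real (boxCross (![(a : ℤ), n, n] : Site 3) 0) *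
          (bondPercolation (zdGraph 3) (criticalProbI 3)).real (boxCross (cubeShape n) 0)) ≤
      (bondPercolation (zdGraph 3) (criticalProbI 3)).real (boxCross (![((a + n - n / 2 : ℕ) : ℤ), n, n] : Site 3) 0) := by
  set μ := -(subadditive_log_hardCrossing (criticalProbI 3) hp n).lim with hμ
  have hμ0 : 0 ≤ μ := rate_nonneg _ hp n
  have hn' : (0 : ℝ) < n := by exact_mod_cast hn
  have hCn := hC n hn
  have hfreq := frequently_exp_mul_hardCrossing_le_shift (criticalProbI 3) hp n (n - n / 2) (ε := 1 / (n : ℝ))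
    (by positivity)
  refine hfreq.mono fun a ha => ?_
  have ht : ((n - n / 2 : ℕ) : ℝ) ≤ n := by exact_mod_cast Nat.sub_le n (n / 2)
  have hshape : (a + n - n / 2 : ℕ) = a + (n - n / 2) := by omega
  rw [hshape]
  refine le_trans ?_ ha
  have hPi1 : (bondPercolation (zdGraph 3) (criticalProbI 3)).real (boxCross (cubeShape n) 0) ≤ 1 := measureReal_le_one
  have hH0 : 0 ≤ (bondPercolation (zdGraph 3) (criticalProbI 3)).real (boxCross (![(a : ℤ), n, n] : Site 3) 0) :=
    measureReal_nonneg
  -- `e^{-(C+1)} ≤ e^{-(μ + 1/n)(n - n/2)}` and `H·Π ≤ H`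
  have hexp : Real.exp (-(C + 1)) ≤ Real.exp (-((μ + 1 / (n : ℝ)) * ((n - n / 2 : ℕ) : ℝ))) := by
    refine Real.exp_le_exp.2 ?_
    have h1 : (μ + 1 / (n : ℝ)) * ((n - n / 2 : ℕ) : ℝ) ≤ (μ + 1 / (n : ℝ)) * n :=
      mul_le_mul_of_nonneg_left ht (by positivity)
    have h2 : (μ + 1 / (n : ℝ)) * n = (n : ℝ) * μ + 1 := by field_simp
    linarith
  calc Real.exp (-(C + 1)) *
        ((bondPercolation (zdGraph 3) (criticalProbI 3)).real (boxCross (![(a : ℤ), n, n] : Site 3) 0) *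
          (bondPercolation (zdGraph 3) (criticalProbI 3)).real (boxCross (cubeShape n) 0))
      ≤ Real.exp (-(C + 1)) *
        (bondPercolation (zdGraph 3) (criticalProbI 3)).real (boxCross (![(a : ℤ), n, n] : Site 3) 0) := by
        refine mul_le_mul_of_nonneg_left ?_ (Real.exp_pos _).le
        exact mul_le_of_le_one_right hH0 hPi1
    _ ≤ Real.exp (-((μ + 1 / (n : ℝ)) * ((n - n / 2 : ℕ) : ℝ))) *
        (bondPercolation (zdGraph 3) (criticalProbI 3)).real (boxCross (![(a : ℤ), n, n] : Site 3) 0) :=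
        mul_le_mul_of_nonneg_right hexp hH0

end Summit.CriticalPhenomena.PercolationContinuityZ3.Theorems.Crossing

end
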